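import Summits.QuantumFields.YangMills.Theorems.UnitScaleTiltFluctuationComparisonRegPrGlobalSlackCanonicalEndToEndChi
import HarnessLib

/-!
# `UnitScaleTiltFluctuationComparisonRegPrGlobalSlackLocalRowChi` — STUB 3⁗χ FROM ONE ROW IN RAW TERM CURRENCY: [King1986]'s LOCAL two-cut-off comparison (3.42) of the
# canonical TERM VALUES at the χ-record's canonical polymerisation, BY NAME — no chart family, no kernels, no configurations (crux `FluctuationComparisonRegPrIntL`,
# stmt-QuantumFields-20520, pen v5kC stub `stub_globalTwoRunSlackFamChi`; width seat ym-ust-20520-w3 g0, «assist w1»; YM₃ on the 3-torus is ladder rung R3, not the Clay problem)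

WHY.  Every by-name socket for 3⁗χ in the tree feeds the registered text through the K1a CHART CALCULUS — six chart rows over one chart family `(Φ, e, B, R)`
(`GlobalSlackCanonicalPolymers.K1aChartRowsCChi/KChi`, ★r1 g4 p574679) or five leg rows (`GlobalSlackKernelLeg.K1aLegRowsRChi`, p575213) — whose composition
`GlobalSlackKernelMatching.polymerCauchyMinAtTSlack_of_charts` lands in the LOCAL SLACK ROW `GlobalSlackLocalToGlobal.PolymerCauchyMinAtTSlack D PT b₀ p₀ κ₁ a σ C`
(per polymer `Y` and term level `1 + j`: `|PT_{K+1}(refine Y) − PT_K(Y) − c| ≤ C·e^{−κ₁𝓛(Y)}·x⁴·(θ(n)²·(L^{−(1+j)})^a + θ(n)^σ)`, [King1986] (3.42) p.660 in the T³ dictionary), after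
which the landed local ⟹ global producer (`GlobalSlackLocalToGlobalCount.globalTwoRunSlackTail_of_polymerSlack_volC`, p530498/★r1 g3) and the five producer rows over the data
core (`pintDecompTrivT_canonCore`, `locCover_canonCore`, `locBlockVolumeC_canonCore`, `locMatched_canonCore`, `termSizeTrivT_canonCore`, ★r1 g4 p572847/p573715/p574458) give
the stub's conclusion `GlobalSlack.GlobalSupRateTSlack`.  The chart triple `(Φ, e, B)` is EXISTENTIALLY quantified in those sockets, so the chart rows carry no content the local
slack row does not (a rank-one quadratic chart `𝓗 ↦ λ(𝓗(c₀))²` with `B(c₀) := √(term value)·v₀` realises all five leg rows from the term rows).  This file therefore exposes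
the local slack row ITSELF as the socket — the one displayed inequality family an analytic seat has to supply, in the currency a cluster expansion produces:

* `K1aLocalSlackRowChi L 𝔠 a₀ a₁ a` — nonnegative constant, slack order `σ ≥ 7`, a coupling threshold, and for every family / coupling / inhabited χ-package a coherent
  family `p : ∀ K, PkgAtV3Chi …` with the given [7]-constants such that the canonical term function `canonPTCore (toCore ∘ p)` obeys the LOCAL SLACK ROW at the χ-datum
  `dataOfV3chi p (canonPolymerCore (toCore ∘ p))`, decay rate the record's `𝔠.κ` (no letter on the record);
* **`globalTwoRunSlackFamChi_of_k1aLocalSlackRowChi : (∀ odd L ≥ 7 …, ∃ a ∈ (0,1), K1aLocalSlackRowChi L 𝔠 a₀ a₁ a) → ⟨stub_globalTwoRunSlackFamChi TEXT⟩`** VERBATIM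
  (OWNER C3 pen `route-R3/ym/plan-g23/C3/birth_v5kC.lean` :43) — threshold `γB ⊓ gammaW L 𝔠 0 0 ⊓ e^{2(1−p₀)}`, `π := canonPolymerCore (toCore ∘ p)`.
HONEST FRAMING.  A CONDITIONAL by-name reduction; the local slack row is the UNPRINTED two-run content of the crux ([King1986] proves its abelian-Higgs analogue) and is
NOT derivable from the χ-record `OfV3ChiAt` alone (its packages at `K` and `K + 1` are independent existential witnesses); nothing of [Balaban1985UV3]/[King1986] is asserted;
registry untouched (`--supports stmt-QuantumFields-20520`); no claim about the crux, d = 4 or the mass gap.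

References: C. King, CMP 102 (1986) 649–677 [King1986] (Thm 3.4 (3.9) p.656, (3.42) p.660, Prop. 3.6 (3.56) p.662); T. Bałaban, CMP 102 (1985) 255–275 [Balaban1985UV3]
((7) p.257, (24) p.262, (43)–(46) pp.266–267, (57) p.270).
-/

set_option autoImplicit false

noncomputable section

namespace Summit.QuantumFields.YangMills.Theorems.GlobalSlackCanonicalPolymers

open scoped BigOperators
open Literature.MathematicalPhysics.QuantumFieldTheory.Balaban1983to89
open Literature.MathematicalPhysics.QuantumFieldTheory.Balaban1983to89.T3ContinuumYM3Torus
open Literature.MathematicalPhysics.QuantumFieldTheory.Balaban1983to89.T3UnitScaleTilt (θBal)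
open Literature.MathematicalPhysics.QuantumFieldTheory.Balaban1983to89.T3AlphaInputsAC
open Literature.MathematicalPhysics.QuantumFieldTheory.Balaban1983to89.T3AlphaPolymerSocket
open Literature.MathematicalPhysics.QuantumFieldTheory.Balaban1983to89.T3AlphaInputsACTwoRun
open Literature.MathematicalPhysics.QuantumFieldTheory.Balaban1983to89.T3AlphaInputsACTwoRunLevel
open Literature.MathematicalPhysics.QuantumFieldTheory.Balaban1983to89.B12TreeDecay (kappa₀ K₀ K₀_pos kappa₀_nonneg)
open Literature.MathematicalPhysics.QuantumFieldTheory.Balaban1985CMP102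
open Literature.MathematicalPhysics.QuantumFieldTheory.Balaban1985CMP102.Setting
open Summit.QuantumFields.Balaban3D.Carriers
open Summit.QuantumFields.Balaban3D.Proofs.Primitives
open Summit.QuantumFields.Balaban3D.Proofs.GroupModelLieC (lieC)
open Summit.QuantumFields.YangMills.Theorems
open Summit.QuantumFields.YangMills.Theorems.GlobalSlack (GlobalSupRateTSlack)
open Summit.QuantumFields.YangMills.Theorems.GlobalSlackKernelMatching (sqrt_le_exp_of_le)
open Summit.QuantumFields.YangMills.Theorems.GlobalSlackLocalToGlobalCount (globalTwoRunSlackTail_of_polymerSlack_volC)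

/-! ## §1 The local slack row at the χ-record's canonical polymerisation, raw term currency -/

/-- **THE LOCAL TWO-CUT-OFF SLACK ROW OF THE CANONICAL TERM FUNCTION AT THE χ-RECORD'S CANONICAL POLYMERISATION** (hypothesis schema, never asserted): a constant `C ≥ 0`, a
slack order `σ ≥ 7`, a coupling threshold `γB > 0`, and for every family of block size `L`, every coupling `γ ≤ γB` in the lane's window and every inhabited χ-package
(`OfV3ChiAt`) a COHERENT family `p : ∀ K, PkgAtV3Chi …` with the given [7]-constants such that, for every pair of runs `K, K+1`, every height `n ≤ K`, every term level
`1 + j < 1 + (K − n)`, every window datum `V` (`PlaqSmall θ(n)`) and every polymer `Y` of the χ-datum at lattice level `K − n`, term level `1 + j`: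
`|canonPTCore_{K+1}(refineSet Y) − canonPTCore_K(Y) − c K n j Y| ≤ C·e^{−𝔠.κ·𝓛_K(Y)}·L^{−4(K−n−1−j)}·(θ(n)²·(L^{−(1+j)})^a + θ(n)^σ)` — [King1986] (3.42) in the T³
dictionary, the row `GlobalSlackLocalToGlobal.PolymerCauchyMinAtTSlack` at `D := dataOfV3chi p (canonPolymerCore (toCore ∘ p))`, `PT := canonPTCore (toCore ∘ p)`, decay rate
the record's `𝔠.κ`.  No chart family, no letter on the record. [cite: King1986, Thm 3.4 (3.9) p.656, (3.42) p.660; Balaban1985UV3, (43)-(44) pp.266-267, (57) p.270] -/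
def K1aLocalSlackRowChi (L : ℕ) (𝔠 : AlphaConsts L (suGroupModel 2).N) (a₀ a₁ a : ℝ) : Prop :=
  ∃ (σ : ℕ) (C γB : ℝ), 7 ≤ σ ∧ 0 ≤ C ∧ 0 < γB ∧
    ∀ (F : T3Family) (γ : ℝ) (hF : F.L = L) (hγ : 0 < γ), γ ≤ γB → ∀ (hγ1 : γ ≤ (min (hF ▸ 𝔠).gamma0 1) ^ 2),
      AlphaInputsT3AC.OfV3ChiAt F (hF ▸ 𝔠) a₀ a₁ →
        ∃ (p : ∀ K, AlphaInputsT3AC.PkgAtV3Chi F (hF ▸ 𝔠) γ hγ hγ1 K), (∀ K, (p K).a₀ = a₀ ∧ (p K).a₁ = a₁) ∧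
          GlobalSlackLocalToGlobal.PolymerCauchyMinAtTSlack (AlphaInputsT3AC.dataOfV3chi p (canonPolymerCore fun K => (p K).toCore))
            (canonPTCore fun K => (p K).toCore) (hF ▸ 𝔠).b₀ (hF ▸ 𝔠).p₀ (hF ▸ 𝔠).κ a σ C

/-! ## §2 The registered stub 3⁗χ from the local slack row, by name -/

/-- **THE PEN's STUB 3⁗χ `stub_globalTwoRunSlackFamChi` FROM THE LOCAL SLACK ROW IN RAW TERM CURRENCY, BY NAME**: if for every odd `L ≥ 7`, every constants record and
[7]-constants there is a rate exponent `0 < a < 1` with `K1aLocalSlackRowChi L 𝔠 a₀ a₁ a`, then the text of `stub_globalTwoRunSlackFamChi` (OWNER C3 pen `birth_v5kC.lean` :43)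
holds VERBATIM — threshold `γB ⊓ gammaW L 𝔠 0 0 ⊓ e^{2(1−p₀)}` (the jet window `cB·r(g_k)g_kp(g_k) ≤ ρ/4` and the old-slice window `8L²B₃Z′·g_kp(g_k) ≤ ½` of the size row, and
the producer's monotonicity window `√γ ≤ e^{1−p₀}`), `π := canonPolymerCore (toCore ∘ p)`; the five producer rows are the core theorems `pintDecompTrivT_canonCore`,
`locCover_canonCore` (at `κ := 𝔠.κ`, `kappa_record_admissible`), `locBlockVolumeC_canonCore`, `locMatched_canonCore`, `termSizeTrivT_canonCore`; composition
`GlobalSlackLocalToGlobalCount.globalTwoRunSlackTail_of_polymerSlack_volC`. [cite: King1986, Thm 3.4 (3.9) p.656, (3.42) p.660; Balaban1985UV3, (7) p.257, (24) p.262, (43)-(46) pp.266-267, (57) p.270] -/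
theorem globalTwoRunSlackFamChi_of_k1aLocalSlackRowChi
    (h : ∀ (L : ℕ), Odd L → 7 ≤ L → ∀ (𝔠 : AlphaConsts L (suGroupModel 2).N) (a₀ a₁ : ℝ), 0 < a₀ → 0 < a₁ → 𝔠.B₃ * a₁ ≤ a₀ →
      ∃ a : ℝ, 0 < a ∧ a < 1 ∧ K1aLocalSlackRowChi L 𝔠 a₀ a₁ a) :
    ∀ (L : ℕ), Odd L → 7 ≤ L → ∀ (𝔠 : Summit.QuantumFields.Balaban3D.Proofs.Primitives.AlphaConsts L (Summit.QuantumFields.Balaban3D.Carriers.suGroupModel 2).N)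
      (a₀ a₁ : ℝ), 0 < a₀ → 0 < a₁ → 𝔠.B₃ * a₁ ≤ a₀ →
      ∃ a : ℝ, 0 < a ∧ ∃ γB : ℝ, 0 < γB ∧ ∀ (F : T3Family) (γ : ℝ) (hF : F.L = L) (hγ : 0 < γ), γ ≤ γB →
        ∀ (hγ1 : γ ≤ (min (hF ▸ 𝔠).gamma0 1) ^ 2),
          Summit.QuantumFields.YangMills.Theorems.AlphaInputsT3AC.OfV3ChiAt F (hF ▸ 𝔠) a₀ a₁ →
          ∃ (p : ∀ K, Summit.QuantumFields.YangMills.Theorems.AlphaInputsT3AC.PkgAtV3Chi F (hF ▸ 𝔠) γ hγ hγ1 K),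
            (∀ K, (p K).a₀ = a₀ ∧ (p K).a₁ = a₁) ∧
            ∃ (π : Summit.QuantumFields.YangMills.Theorems.AlphaInputsT3AC.PolymerT3 F) (σ : ℕ) (C : ℝ), 7 ≤ σ ∧ 0 ≤ C ∧
              Summit.QuantumFields.YangMills.Theorems.GlobalSlack.GlobalSupRateTSlack (Summit.QuantumFields.YangMills.Theorems.AlphaInputsT3AC.dataOfV3chi p π) (hF ▸ 𝔠).b₀ (hF ▸ 𝔠).p₀ a σ C := by
  intro L hLo h7 𝔠 a₀ a₁ ha0 ha1 hw
  obtain ⟨a, ha, ha1', σ, C, γB, hσ, hC, hγB, hall⟩ := h L hLo h7 𝔠 a₀ a₁ ha0 ha1 hw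
  refine ⟨a, ha, min γB (min (gammaW L 𝔠 0 0) (Real.exp (2 * (1 - 𝔠.p₀)))),
    lt_min hγB (lt_min (gammaW_pos L 𝔠 0 0) (Real.exp_pos _)), fun F γ hF hγ hγle hγ1 hOf => ?_⟩
  subst hF
  have hγB' : γ ≤ γB := hγle.trans (min_le_left _ _)
  have hW : γ ≤ gammaW F.L 𝔠 0 0 := hγle.trans ((min_le_right _ _).trans (min_le_left _ _))
  have hγe : Real.sqrt γ ≤ Real.exp (1 - 𝔠.p₀) := sqrt_le_exp_of_le (hγle.trans ((min_le_right _ _).trans (min_le_right _ _)))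
  have h1 : γ ≤ gammaθ 𝔠.b₀ (𝔠.p₀ + 𝔠.r₀) (𝔠.ρ / (4 * max 1 𝔠.cB)) := hW.trans ((min_le_right _ _).trans (min_le_left _ _))
  have h2 : γ ≤ gammaθ 𝔠.b₀ 𝔠.p₀ (1 / (2 * (8 * ((F.L : ℝ) + 1) ^ 2 * 𝔠.B₃ * 𝔠.Zfull))) := hW.trans ((min_le_right _ _).trans (min_le_right _ _))
  have hγ1' : γ ≤ 1 := hγ1.trans (sq_min_one_le _ 𝔠.gamma0_pos)
  obtain ⟨p, hp, hPC⟩ := hall F γ rfl hγ hγB' hγ1 hOf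
  -- the projected family of data cores
  set q : ∀ K, AlphaInputsT3AC.PkgCoreV3 F 𝔠 γ hγ hγ1 K := fun K => (p K).toCore with hq
  have hw1 := fun K k hk => window_jet (hγ := hγ) (hγ1 := hγ1) h1 K k hk
  have hw2 := fun K k hk => window_oldSlice (hγ := hγ) (hγ1 := hγ1) h2 K k hk
  obtain ⟨hκ0, hκ₀⟩ := kappa_record_admissible 𝔠
  have hCT : 0 ≤ max (newConst 𝔠) (oldConst 𝔠 * (F.L : ℝ) ^ 4 * Real.exp (𝔠.κ * (F.L : ℝ) ^ 3)) := le_max_of_le_left (newConst_nonneg 𝔠)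
  obtain ⟨σ₀, C₀, hσ₀, hC₀, hG⟩ := globalTwoRunSlackTail_of_polymerSlack_volC (D := AlphaInputsT3AC.dataOfCoreV3 q (canonPolymerCore q))
    hγ hγ1' hγe 𝔠.b₀_pos 𝔠.p₀_pos.le ha ha1' hC hCT hσ
    (pintDecompTrivT_canonCore q) (locCover_canonCore q hκ0.le hκ₀) (locBlockVolumeC_canonCore q) (locMatched_canonCore q)
    (termSizeTrivT_canonCore q hκ0 le_rfl hw1 hw2) hPC
  exact ⟨p, hp, canonPolymerCore q, σ₀, C₀, hσ₀, hC₀, hG⟩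

end Summit.QuantumFields.YangMills.Theorems.GlobalSlackCanonicalPolymers

end
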